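import Summits.QuantumFields.BalabanUV.Beta.D1BFx.TorusAveragingEntries
import Summits.QuantumFields.BalabanUV.Beta.D1BFx.TorusMassiveResolvent

/-!
# `BalabanUV.Beta.D1BFx.TorusAveragingGram` — road «BF-x», binder row D1, slot (K), X₃(ii) ROUTE T, brick **TB2 3b-Q «𝒬-ENTRY BOOKKEEPING»** PART 2
# (`d = 3`): **`Q̂·(reblock n Ga)^·Q̂ᵀ = (toF (gramM n Ga))^`** — the torus coarse Gram of `CoarseGramInverse` IS `Q̂ Ĝ Q̂ᵀ` in the sorted currency,
# for a decaying block-covariant fine leg `Ga`, and at the road's legs `Ga (m+1) a` modulo `Spr` (owner ruling ρ-g6-3 (ii)–(iii), journal l.22016)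

CONTENT (all [folklore]): `compF_QF_Ga_QF : compF (compF (QF n) (reblock n Ga)) (trF (QF n)) = toF (gramM n Ga)` for ANY `Ga : MKer 4 (Fin 4)` (both
sides = the finite double leg sum of `CoarseGramInverse.gramM_eq_legSum`, via PART 1's contractions `sum_tsum_QF_mul`∕`sum_tsum_mul_QF`);
`isPeriodic₂_trF_QF`, `rowBound_trF_QF` (column sums of `QF`: one block index per leg), `summable_abs_row_QF_Ga`; **`Qhat_mul_Ghat_mul_QhatT`**
(`Decays Ga`, `shiftK (n•t) Ga = Ga`; two product rules `periodiseF_compF_matrix` + `periodiseF_trF`) and **`Qhat_mul_Ghat_mul_QhatT_Ga`**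
(`GluonLeg.shiftK_Ga`; modulo `Spr (Ga (m+1) a)`, the printed [B5] decay) — with `CoarseGramInverse.gram_torus_inv_eq_Ga` the `C := Ĉ` of
`BorderedInverseMassive.kkt_inv_eq_massiveBlocks` for TB2 3c (owner).  §4: the two torus letters of 3c DISCHARGED — `X1aM_eq_add_smul`, **`Xhat_eq_add_smul`**
(`hlin`: `X̂(a') = X̂(0) + a'•Q̂ᵀQ̂`), **`Qhat_mul_Ghat_mul_QhatT_road`** (`hgram`), hence **`isUnit_det_NT_road`**, **`inv_NT_eq_fromBlocks_road`**: the owner's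
`TorusMassiveResolvent` conclusions modulo `Spr (Ga (m+1) a)` ONLY.
HONEST FRAMING (cell contract, verbatim): «discharging `BetaPertH` makes Bałaban's UV stability UNCONDITIONAL — a real constructive-QFT result; it
is NOT the continuum limit and NOT the Clay problem.»  HONEST DEPENDENCY (verbatim): «continuum YM on T⁴ ⇐ BetaPertH ∧ nine spine estimates (0/9
proved); BetaPertH ⇐ (D1) ∧ (D4) ∧ CAP+tail; G-an2-4 gates asym, D1 and NE2/3/4.»  [folklore] bookkeeping BY NAME; no `Prop` is minted, nothing is
cited, no wall binder is instantiated; 0 sorry.  NOT D1, NOT BetaPertH.  ABSOLUTE RULE (cell, verbatim): «No internally-minted statement may enter as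
a cited fact. Every hypothesis is either kernel-proved in this package or a verbatim quotation of a PUBLISHED theorem with page reference. The
manuscript(s) under audit are NOT citable for their own disputed steps — they are the thing under adjudication; programme-internal
(2001/route/tribunal) claims are never citable.»  Provenance: D1 formalisation swarm, unit `b2b-balaban-beta-d1-formalise-leaf-03` (gen 8), 2026-08-20.
-/

noncomputable section

namespace Summit.QuantumFields.BalabanUV.Beta.D1BFx.TorusAveragingGram

open Matrix Finset
open Literature.Probability.LatticeModels (TorusSite Torus.proj)
open Literature.MathematicalPhysics.QuantumFieldTheory.LatticeForm (repZ quo)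
open Literature.MathematicalPhysics.QuantumFieldTheory.Balaban1983to89
open Literature.MathematicalPhysics.QuantumFieldTheory.Balaban1983to89.Beta
open ExpKernelCalculus (MKer Decays shiftK Zl)
open AffineAveraging (box toSite unitVec contourSum)
open OneStepResolventKernel (Fib)
open OneStepKernelFamily (LegIdx legPt)
open Summit.QuantumFields.BalabanUV.Beta.TameKernelCalculus (Spr)
open Summit.QuantumFields.BalabanUV.Beta.D1BFx.FibredPeriodisation
open Summit.QuantumFields.BalabanUV.Beta.D1BFx.SortedKernels
open Summit.QuantumFields.BalabanUV.Beta.D1BFx.SortedReblocking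
open Summit.QuantumFields.BalabanUV.Beta.D1BFx.SortedPack
open Summit.QuantumFields.BalabanUV.Beta.D1BFx.TorusCombKKT (I J Qhat)
open Summit.QuantumFields.BalabanUV.Beta.D1BFx.PeriodicArrays (toF Kfib_toF)
open Summit.QuantumFields.BalabanUV.Beta.D1BFx.CoarseGramInverse (gramM gramM_eq_legSum)
open Summit.QuantumFields.BalabanUV.Beta.D1BFx.TorusAveragingEntries
open scoped BigOperators

/-! ## The coarse Gram in the sorted currency (`d = 3`) -/

section Gram
variable {n : ℕ} [NeZero n]

set_option maxHeartbeats 800000 in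
/-- [folklore] **`𝒬·Ga·𝒬ᵀ` IN SORTED FORM IS THE COARSE GRAM**: `compF (compF (QF n) (reblock n Ga)) (trF (QF n)) = toF (gramM n Ga)` for ANY
`Ga : MKer 4 (Fin 4)` — both sides are the finite double leg sum of `CoarseGramInverse.gramM_eq_legSum`. -/
theorem compF_QF_Ga_QF (Ga : MKer 4 (Fin 4)) :
    compF (compF (QF (d := 3) n) (reblock n Ga)) (trF (QF (d := 3) n)) = toF (gramM n Ga) := by
  funext ⟨y, κ⟩ ⟨y', l⟩
  rw [show toF (gramM n Ga) (y, κ) (y', l) = gramM n Ga y y' κ l from rfl, gramM_eq_legSum]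
  -- the inner composition: `(QF ∘ reblock Ga) (y,κ) (w',zc) = Σ_j Ga (legPt κ y j) (finePt w' zc.1) κ zc.2`
  have inner : ∀ w' (zc : TorusSite 4 n × Fin 4), compF (QF (d := 3) n) (reblock n Ga) (y, κ) (w', zc)
      = ∑ j ∈ LegIdx 3 n, Ga (legPt n (Sum.inl κ : Fib 3) y j) (finePt n w' zc.1) κ zc.2 := by
    rintro w' ⟨z', c'⟩
    simp only [compF]
    exact sum_tsum_QF_mul y κ (fun x c => Ga x (finePt n w' z') c c')
  show (∑ zc : TorusSite 4 n × Fin 4, ∑' w', compF (QF (d := 3) n) (reblock n Ga) (y, κ) (w', zc) * trF (QF (d := 3) n) (w', zc) (y', l)) = _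
  simp only [trF_apply, inner]
  -- the outer composition against `QFᵀ`: again a leg sum, of the coarse bond `(l, y′)`
  rw [sum_tsum_mul_QF y' l (fun x c => ∑ j ∈ LegIdx 3 n, Ga (legPt n (Sum.inl κ : Fib 3) y j) x κ c), Finset.sum_comm]

/-- [folklore] Transposed fibres of `QF` are jointly periodic. -/
theorem isPeriodic₂_trF_QF (q : ℕ) (zc : TorusSite 4 n × Fin 4) (κ : Fin 4) : IsPeriodic₂ q (Kfib (trF (QF (d := 3) n)) zc κ) :=
  fun x y t => isPeriodic₂_QF q κ zc y x t

/-- [folklore] A common row bound for the TRANSPOSED fibres of `QF` (column sums of `QF`): at most one block index per leg. -/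
theorem rowBound_trF_QF (zc : TorusSite 4 n × Fin 4) (κ : Fin 4) :
    RowBound (Kfib (trF (QF (d := 3) n)) zc κ) ((LegIdx 3 n).card : ℝ) := by
  intro w
  refine ⟨summable_abs_QF_col κ zc w, ?_⟩
  obtain ⟨z, c⟩ := zc
  have hs : ∀ j ∈ LegIdx 3 n, Summable fun y : Fin 4 → ℤ =>
      (if c = κ ∧ finePt n w z = legPt n (Sum.inl κ : Fib 3) y j then (1 : ℝ) else 0) := fun j hj =>
    summable_of_ne_finset_zero (s := {AveragingContours.blk n (finePt n w z - (j.2 : ℤ) • unitVec κ)}) fun y hy => by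
      rw [Finset.mem_singleton] at hy
      rw [if_neg]
      rintro ⟨-, h⟩
      exact hy (by rw [h]; exact (quo_legPt hj).symm)
  have hle : ∀ y, |Kfib (trF (QF (d := 3) n)) (z, c) κ w y|
      ≤ ∑ j ∈ LegIdx 3 n, (if c = κ ∧ finePt n w z = legPt n (Sum.inl κ : Fib 3) y j then (1 : ℝ) else 0) := by
    intro y
    rw [Kfib_apply, trF_apply, QF_apply_legSum, abs_of_nonneg (Finset.sum_nonneg fun j _ => by split_ifs <;> norm_num)]
  calc ∑' y, |Kfib (trF (QF (d := 3) n)) (z, c) κ w y|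
      ≤ ∑' y, ∑ j ∈ LegIdx 3 n, (if c = κ ∧ finePt n w z = legPt n (Sum.inl κ : Fib 3) y j then (1 : ℝ) else 0) :=
        Summable.tsum_le_tsum hle (summable_abs_QF_col κ (z, c) w) (summable_sum fun j hj => hs j hj)
    _ = ∑ j ∈ LegIdx 3 n, ∑' y, (if c = κ ∧ finePt n w z = legPt n (Sum.inl κ : Fib 3) y j then (1 : ℝ) else 0) :=
        Summable.tsum_finsetSum fun j hj => hs j hj
    _ ≤ ∑ j ∈ LegIdx 3 n, (1 : ℝ) := by
        refine Finset.sum_le_sum fun j hj => ?_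
        have h1 : ∑' y : Fin 4 → ℤ, (if c = κ ∧ finePt n w z = legPt n (Sum.inl κ : Fib 3) y j then (1 : ℝ) else 0)
            ≤ ∑' y : Fin 4 → ℤ, (if y = AveragingContours.blk n (finePt n w z - (j.2 : ℤ) • unitVec κ) then (1 : ℝ) else 0) := by
          refine Summable.tsum_le_tsum (fun y => ?_) (hs j hj) (summable_of_ne_finset_zero
            (s := {AveragingContours.blk n (finePt n w z - (j.2 : ℤ) • unitVec κ)}) fun y hy => by
              rw [Finset.mem_singleton] at hy; rw [if_neg hy])
          by_cases h : c = κ ∧ finePt n w z = legPt n (Sum.inl κ : Fib 3) y j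
          · rw [if_pos h, if_pos (by rw [h.2]; exact (quo_legPt hj).symm)]
          · rw [if_neg h]; split_ifs <;> norm_num
        rw [tsum_ite_eq] at h1
        exact h1
    _ = ((LegIdx 3 n).card : ℝ) := by simp

set_option maxHeartbeats 800000 in
/-- [folklore] Rows of `QF ∘ reblock Ga` are absolutely summable for a decaying `Ga` (a finite leg sum of decaying rows). -/
theorem summable_abs_row_QF_Ga {Ga : MKer 4 (Fin 4)} {C δ : ℝ} (hGa : Decays Ga C δ) (hδ : 0 < δ) (i : Fin 4)
    (zc : TorusSite 4 n × Fin 4) (y : Fin 4 → ℤ) :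
    Summable fun w' => |Kfib (compF (QF (d := 3) n) (reblock n Ga)) i zc y w'| := by
  obtain ⟨z', c'⟩ := zc
  have e : (fun w' => Kfib (compF (QF (d := 3) n) (reblock n Ga)) i (z', c') y w')
      = fun w' => ∑ j ∈ LegIdx 3 n, Ga (legPt n (Sum.inl i : Fib 3) y j) (finePt n w' z') i c' := by
    funext w'
    rw [Kfib_apply]
    simp only [compF]
    exact sum_tsum_QF_mul y i (fun x c => Ga x (finePt n w' z') c c')
  have hsum : Summable fun w' => |∑ j ∈ LegIdx 3 n, Ga (legPt n (Sum.inl i : Fib 3) y j) (finePt n w' z') i c'| := by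
    refine (summable_sum fun j _ => ?_).abs
    exact ((summable_abs_row hGa hδ (legPt n (Sum.inl i : Fib 3) y j) i c').of_abs).comp_injective (finePt_left_injective z')
  refine hsum.congr fun w' => ?_
  rw [congrFun e w']

/-- [folklore] **`Q̂·(reblock n Ga)^·Q̂ᵀ = (toF (gramM n Ga))^`** on every coarse torus, for a decaying block-covariant leg `Ga`. -/
theorem Qhat_mul_Ghat_mul_QhatT {Ga : MKer 4 (Fin 4)} {C δ : ℝ} (hGa : Decays Ga C δ) (hδ : 0 < δ)
    (hGac : ∀ t : Fin 4 → ℤ, shiftK ((n : ℤ) • t) Ga = Ga) (p : ℕ) [NeZero p] :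
    Qhat (d := 3) n p * Matrix.of (periodiseF p (reblock n Ga)) * (Qhat (d := 3) n p)ᵀ
      = Matrix.of (periodiseF p (toF (gramM n Ga))) := by
  rw [Qhat_eq, ← periodiseF_compF_matrix (fun κ zc y => summable_abs_QF_row κ zc y) (fun i j => isPeriodic₂_reblock hGac p i j)
      (fun i j => rowBound_reblock hGa hδ i j),
    ← periodiseF_trF (fun κ zc => isPeriodic₂_QF p κ zc), ← compF_QF_Ga_QF Ga]
  exact (periodiseF_compF_matrix (fun i zc y => summable_abs_row_QF_Ga hGa hδ i zc y) (fun zc κ => isPeriodic₂_trF_QF p zc κ)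
    (fun zc κ => rowBound_trF_QF zc κ)).symm

/-- [folklore] **AT THE ROAD'S LEGS** `Ga (m+1) a` (block-covariant by `GluonLeg.shiftK_Ga`), modulo the displayed decay `Spr (Ga (m+1) a)` (the
printed [B5] input, as in `CoarseGramInverse`): `Q̂·(reblock (m+1) (Ga (m+1) a))^·Q̂ᵀ = (toF (gramM (m+1) (Ga (m+1) a)))^` — whose inverse on every
coarse torus is `((m+1)⁻⁸·Cun (m+1) a)^` (`CoarseGramInverse.gram_torus_inv_eq_Ga`). -/
theorem Qhat_mul_Ghat_mul_QhatT_Ga (m : ℕ) (a : ℝ) (hGa : Spr (GluonLeg.Ga (m + 1) a)) (p : ℕ) [NeZero p] :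
    Qhat (d := 3) (m + 1) p * Matrix.of (periodiseF p (reblock (m + 1) (GluonLeg.Ga (m + 1) a))) * (Qhat (d := 3) (m + 1) p)ᵀ
      = Matrix.of (periodiseF p (toF (gramM (m + 1) (GluonLeg.Ga (m + 1) a)))) := by
  obtain ⟨C, δ, hδ, h⟩ := hGa
  exact Qhat_mul_Ghat_mul_QhatT h hδ (fun t => GluonLeg.shiftK_Ga (m + 1) a (Nat.succ_le_of_lt (Nat.succ_pos m)) t) p

end Gram

/-! ## §4 The two torus letters `hlin`, `hgram` of brick 3c (`TorusBorderedResolvent`∕`TorusMassiveResolvent`), discharged -/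

section Letters

open Summit.QuantumFields.BalabanUV.Beta.D1BFx.TorusBorderedResolvent (X1aM Xhat Ghat Chat NT)
open Summit.QuantumFields.BalabanUV.Beta.D1BFx.TorusMassiveResolvent (summable_X1aM_row isUnit_det_NT_of_letters inv_NT_eq_fromBlocks_of_letters)
open Summit.QuantumFields.BalabanUV.Beta.D1BFx.VectorLegKernelForm (X1aKer_apply)

/-- [folklore] **THE VECTOR-LEG KERNEL IS AFFINE IN THE AVERAGING WEIGHT**: `X1aM n a a' = X1aM n a 0 + a' • qqM n` — by `X1aKer_apply` the weight
`a'` enters only through the colour-diagonal mass term `a'·qqKer`. -/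
theorem X1aM_eq_add_smul (n : ℕ) [NeZero n] (a a' : ℝ) : X1aM n a a' = X1aM n a 0 + a' • qqM (d := 3) n := by
  funext x w κ l
  simp only [X1aM, Pi.add_apply, Pi.smul_apply, smul_eq_mul, qqM, X1aKer_apply]
  split_ifs <;> ring

/-- [folklore] Re-blocking is additive and homogeneous: `reblock n (A + c • B) = reblock n A + (c · reblock n B)` (pointwise, by `rfl`). -/
theorem reblock_add_smul {D : ℕ} {F : Type*} (n : ℕ) (A B : MKer D F) (c : ℝ) :
    reblock n (A + c • B) = reblock n A + fun i j => c * reblock n B i j := by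
  funext i j
  rfl

/-- [folklore] Fibres of `reblock (m+1) (X1aM (m+1) a a')` are summable (`TorusMassiveResolvent.summable_X1aM_row` along the injective re-blocking). -/
theorem summable_Kfib_reblock_X1aM (m : ℕ) {a : ℝ} (ha : 0 < a) (a' : ℝ) (i j : TorusSite 4 (m + 1) × Fin 4) (y : Fin 4 → ℤ) :
    Summable (Kfib (reblock (m + 1) (X1aM (m + 1) a a')) i j y) := by
  obtain ⟨z, κ⟩ := i
  obtain ⟨z', l⟩ := j
  have e : Kfib (reblock (m + 1) (X1aM (m + 1) a a')) (z, κ) (z', l) y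
      = (fun x' => X1aM (m + 1) a a' (finePt (m + 1) y z) x' κ l) ∘ fun y' => finePt (m + 1) y' z' := by
    funext y'
    simp only [Kfib_reblock, Function.comp_apply]
  rw [e]
  exact (summable_X1aM_row m ha a' κ l _).comp_injective (finePt_left_injective z')

/-- [folklore] **THE LETTER `hlin` DISCHARGED**: `X̂(a') = X̂(0) + a' • Q̂ᵀQ̂` on every coarse torus, for every weight `a'` (from `X1aM_eq_add_smul`,
`periodiseF_add`∕`periodiseF_const_mul` and PART 1's `QhatT_mul_Qhat`); `0 < a` is only used for the summability of the gauge-fixing rows. -/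
theorem Xhat_eq_add_smul (m : ℕ) {a : ℝ} (ha : 0 < a) (p : ℕ) [NeZero p] (a' : ℝ) :
    Xhat m a p a' = Xhat m a p 0 + a' • ((Qhat (d := 3) (m + 1) p)ᵀ * Qhat (d := 3) (m + 1) p) := by
  rw [QhatT_mul_Qhat]
  ext i j
  simp only [Xhat, Matrix.add_apply, Matrix.smul_apply, Matrix.of_apply, smul_eq_mul]
  have hQ : ∀ i j y, Summable (Kfib (fun i' j' => a' * reblock (m + 1) (qqM (d := 3) (m + 1)) i' j') i j y) := fun i j y =>
    ((summable_Kfib_reblock_qqM (d := 3) i j y).mul_left a').congr fun y' => by simp only [Kfib_apply]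
  rw [X1aM_eq_add_smul, reblock_add_smul, periodiseF_add (fun i j y => summable_Kfib_reblock_X1aM m ha 0 i j y) hQ,
    periodiseF_const_mul]

/-- [folklore] **THE LETTER `hgram` DISCHARGED** (modulo `Spr (Ga (m+1) a)`, the printed [B5] decay): `Q̂·Ĝ·Q̂ᵀ = (toF (gramM (m+1) (Ga (m+1) a)))^`
with `Ĝ = TorusBorderedResolvent.Ghat`. -/
theorem Qhat_mul_Ghat_mul_QhatT_road (m : ℕ) (a : ℝ) (hGa : Spr (GluonLeg.Ga (m + 1) a)) (p : ℕ) [NeZero p] :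
    Qhat (d := 3) (m + 1) p * Ghat m a p * (Qhat (d := 3) (m + 1) p)ᵀ
      = Matrix.of (periodiseF p (toF (gramM (m + 1) (GluonLeg.Ga (m + 1) a)))) :=
  Qhat_mul_Ghat_mul_QhatT_Ga m a hGa p

/-- [folklore] **`N_T` IS INVERTIBLE, modulo `Spr (Ga (m+1) a)` ONLY** — `TorusMassiveResolvent.isUnit_det_NT_of_letters` with both 3b-Q letters
discharged. -/
theorem isUnit_det_NT_road (m : ℕ) {a : ℝ} (ha : 0 < a) (hGa : Spr (GluonLeg.Ga (m + 1) a)) (p : ℕ) [NeZero p] :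
    IsUnit (NT m a p).det :=
  isUnit_det_NT_of_letters (m := m) (p := p) ha hGa (Xhat_eq_add_smul m ha p _) (Qhat_mul_Ghat_mul_QhatT_road m a hGa p)

/-- [folklore] **THE BLOCKS OF `N_T⁻¹`, modulo `Spr (Ga (m+1) a)` ONLY** — `TorusMassiveResolvent.inv_NT_eq_fromBlocks_of_letters` with both 3b-Q
letters discharged: `N_T⁻¹ = fromBlocks (½(Ĝ − ĜQ̂ᵀĈQ̂Ĝ)) (ĜQ̂ᵀĈ) (ĈQ̂Ĝ) ((2a∕(m+1)⁸)•1 − 2Ĉ)`. -/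
theorem inv_NT_eq_fromBlocks_road (m : ℕ) {a : ℝ} (ha : 0 < a) (hGa : Spr (GluonLeg.Ga (m + 1) a)) (p : ℕ) [NeZero p] :
    (NT m a p)⁻¹
      = Matrix.fromBlocks
          ((1 / 2 : ℝ) • (Ghat m a p - Ghat m a p * (Qhat (d := 3) (m + 1) p)ᵀ * Chat m a p * Qhat (d := 3) (m + 1) p * Ghat m a p))
          (Ghat m a p * (Qhat (d := 3) (m + 1) p)ᵀ * Chat m a p)
          (Chat m a p * Qhat (d := 3) (m + 1) p * Ghat m a p)
          ((2 * a / ((m + 1 : ℕ) : ℝ) ^ 8) • (1 : Matrix (J 3 p) (J 3 p) ℝ) - (2 : ℝ) • Chat m a p) :=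
  inv_NT_eq_fromBlocks_of_letters (m := m) (p := p) ha hGa (Xhat_eq_add_smul m ha p _) (Qhat_mul_Ghat_mul_QhatT_road m a hGa p)

end Letters

end Summit.QuantumFields.BalabanUV.Beta.D1BFx.TorusAveragingGram

end
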